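/-
Copyright: the b2b-balaban T⁴-continuum CRUX team, row NE7b OWNER lineage `t4-ne7b-p1` (gen 143). Project licence.
-/
import Summits.QuantumFields.BalabanUV.T4Continuum.Spine.NE7b.SupFifthFormObservables

/-!
# THE FORM OF `∂⁵W`, GROUPS ONE TO THREE (SCOPING (d15)(v)): (521)'s centred display of `∂⁴W(ψ)[m,h,k,l]` is `⟨D⟩ − Σ₄Cov(C,A) − Σ₃Cov(B,B)
# + Σ₆κ₃ᶜ(B,A,A) − u₄(A,A,A,A)`; `∂⁵W(ψ₀)[n,m,h,k,l]` is its derivative along `ψ_s = ψ₀ + s·n`, taken GROUP BY GROUP (the display is linear; the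
# full order-5 display is ≈ 530 lines and is never written in one piece).  This file differentiates the mean group (RULE 1 on `D = U⁗(·)mhkl`),
# the `Cov(C,A)` group (RULE 2 ×4) and the `Cov(B,B)` group (RULE 2 ×3), with `∂_nA_v = U″nv`, `∂_nB_{xy} = U‴nxy`, `∂_nC_{xyz} = U⁗nxyz`,
# `∂_nD = U⁽⁵⁾nmhkl` substituted ((590)'s evaluation identities): together `⟨E⟩ − Cov(D,A_n)`, four `Cov(∂C,A) + Cov(C,∂A) − κ₃ᶜ(C,A,A_n)`, three
# `Cov(∂B,B′) + Cov(B,∂B′) − κ₃ᶜ(B,B′,A_n)` — 2 + 12 + 9 of the 52 placements (row NE7b, node U5c; (581) `hasDerivAt_tilted_mean_line`,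
# `hasDerivAt_tilted_cov_line`, `class_grad_abs_le`, `class_grad_fderiv_le`, (590) BY NAME; [folklore])

Cell `pub-balaban`, sub-cell `t4`, spine estimate NE7b (`T4WeightBudget.RelWeightBound`; the cell's OWN estimate — NOT PRINTED in
[Bałaban 1983–89], NOT PROVED).  Crux-route work under `Spine/NE7b/` by the row OWNER (`t4-ne7b-p1` gen 143, file (591)) under FREEZE
(0)'s crux-prover clause; NOTHING of Bałaban's is named as a Lean object, valued or asserted; no `T4Continuum/Support` leaf typed; no
`def`, no notation (every cumulant WRITTEN OUT); zero `sorry`.  Imports (BY NAME): the OWNER's (590) `…SupFifthFormObservables` (through it (581)).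

WHAT IS PROVED ([folklore]): **`hasDerivAt_display4_mean_line`**, **`hasDerivAt_display4_covCA_line`**, **`hasDerivAt_display4_covBB_line`**; toy.

HONEST (what this is NOT).  Calculus bookkeeping; groups four (κ₃ᶜ, RULE 3 ×6) and five (u₄, RULE 4), and the order-5 assembly are NOT typed
here.  Scalar skeleton ((A3), NC-NE7b-α UNRULED); nothing of Bałaban's asserted.  BY-NAME EFFECT ON THE WALL: NONE.  NE7b NOT PRINTED ∕ NOT
PROVED; spine PROVED 0∕9; rung (B)+1 — the programme's measures remain FINITE-torus statements; NOT the mass gap, NOT Clay.  HONEST DEPENDENCY: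
continuum YM on T⁴ ⇐ BetaPertH ∧ nine spine estimates (0∕9 proved); BetaPertH ⇐ (D1) ∧ (D4) ∧ CAP+tail; G-an2-4 gates asym, D1 and NE2∕3∕4.
-/

set_option autoImplicit false
set_option maxSynthPendingDepth 4

noncomputable section

namespace Summit.QuantumFields.BalabanUV.T4Continuum.NE7b.SupFifthFormGroupsOne

open MeasureTheory ProbabilityTheory Real Set Function Finset Matrix
open scoped BigOperators
open SupTiltedMomentConstituents (hasFDerivAt_entry_one hasFDerivAt_entry_two)
open SupTiltedMomentPhiConstituent (hasFDerivAt_entry_three)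
open SupTiltedCumulantCalculusOne (class_grad_abs_le class_grad_fderiv_le hasDerivAt_tilted_mean_line hasDerivAt_tilted_cov_line)
open SupFifthFormObservables (hasFDerivAt_entry_four entry_one_fderiv_apply entry_two_fderiv_apply entry_three_fderiv_apply
  entry_four_fderiv_apply class_hess_abs_le class_hess_fderiv_le class_third_abs_le class_third_fderiv_le class_fourth_abs_le
  class_fourth_fderiv_le continuous_entry_one_fderiv continuous_entry_two_fderiv continuous_entry_three_fderiv continuous_entry_four_fderiv)

variable {ι : Type} [Fintype ι] [DecidableEq ι]

variable {Γ : Matrix ι ι ℝ} {γop : ℝ} {U : EuclideanSpace ℝ ι → ℝ} {U' : EuclideanSpace ℝ ι → EuclideanSpace ℝ ι →L[ℝ] ℝ}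
  {U'' : EuclideanSpace ℝ ι → EuclideanSpace ℝ ι →L[ℝ] EuclideanSpace ℝ ι →L[ℝ] ℝ}
  {U₃ : EuclideanSpace ℝ ι → EuclideanSpace ℝ ι →L[ℝ] EuclideanSpace ℝ ι →L[ℝ] EuclideanSpace ℝ ι →L[ℝ] ℝ}
  {U₄ : EuclideanSpace ℝ ι → EuclideanSpace ℝ ι →L[ℝ] EuclideanSpace ℝ ι →L[ℝ] EuclideanSpace ℝ ι →L[ℝ] EuclideanSpace ℝ ι →L[ℝ] ℝ}
  {U₅ : EuclideanSpace ℝ ι →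
    EuclideanSpace ℝ ι →L[ℝ] EuclideanSpace ℝ ι →L[ℝ] EuclideanSpace ℝ ι →L[ℝ] EuclideanSpace ℝ ι →L[ℝ] EuclideanSpace ℝ ι →L[ℝ] ℝ}
  {κ₀ κ₁ κ₂ κ₃ κ₄ κ₅ a τ δ θ : ℝ}

set_option synthInstance.maxHeartbeats 200000 in
/-- **The mean group**: `d∕ds ⟨U⁗mhkl⟩_s = ⟨U⁽⁵⁾nmhkl⟩ − Cov(U⁗mhkl, A_n)` (RULE 1 on `D`). [folklore] -/
theorem hasDerivAt_display4_mean_line (hΓ : Γ.PosSemidef) (hΓop : (γop • (1 : Matrix ι ι ℝ) - Γ).PosSemidef) (Y : Finset ι)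
    (hUd : ∀ φ : EuclideanSpace ℝ ι, HasFDerivAt U (U' φ) φ) (hU'd : ∀ φ : EuclideanSpace ℝ ι, HasFDerivAt U' (U'' φ) φ)
    (hU₄d : ∀ φ : EuclideanSpace ℝ ι, HasFDerivAt U₄ (U₅ φ) φ) (hU₅c : Continuous U₅)
    (hκ₀ : 0 ≤ κ₀) (hκ₁ : 0 ≤ κ₁) (ha : 0 ≤ a) (hτ : 0 < τ) (hδ : 0 < δ) (hθ0 : 0 < θ) (hθ1 : θ < 1) (hκθ : (2 * κ₀ * (1 + τ) + 4 * δ) * γop ≤ θ)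
    (hstab : ∀ φ : EuclideanSpace ℝ ι, -(κ₀ * ∑ x ∈ Y, φ x ^ 2) ≤ U φ) (hU'b : ∀ φ : EuclideanSpace ℝ ι, ‖U' φ‖ ≤ κ₁ * (a + ∑ x ∈ Y, φ x ^ 2))
    (hU''b : ∀ φ : EuclideanSpace ℝ ι, ‖U'' φ‖ ≤ κ₂) (hU₄b : ∀ φ : EuclideanSpace ℝ ι, ‖U₄ φ‖ ≤ κ₄) (hU₅b : ∀ φ : EuclideanSpace ℝ ι, ‖U₅ φ‖ ≤ κ₅)
        (ψ₀ n m h k l : EuclideanSpace ℝ ι) :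
    HasDerivAt (fun s : ℝ => ((∫ ω : EuclideanSpace ℝ ι, exp (-U (ω + (ψ₀ + s • n))) ∂(multivariateGaussian 0 Γ))⁻¹ * (∫ ω : EuclideanSpace ℝ ι, exp
        (-U (ω + (ψ₀ + s • n))) * U₄ (ω + (ψ₀ + s • n)) m h k l ∂(multivariateGaussian 0 Γ))))
      (((∫ ω : EuclideanSpace ℝ ι, exp (-U (ω + ψ₀)) ∂(multivariateGaussian 0 Γ))⁻¹ * (∫ ω : EuclideanSpace ℝ ι, exp (-U (ω + ψ₀)) * U₅ (ω + ψ₀) n m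
          h k l ∂(multivariateGaussian 0 Γ))) - ((∫ ω : EuclideanSpace ℝ ι, exp (-U (ω + ψ₀)) ∂(multivariateGaussian 0 Γ))⁻¹ * (∫ ω : EuclideanSpace
          ℝ ι, exp (-U (ω + ψ₀)) * (U₄ (ω + ψ₀) m h k l * U' (ω + ψ₀) n) ∂(multivariateGaussian 0 Γ)) - ((∫ ω : EuclideanSpace ℝ ι, exp (-U (ω + ψ₀))
          ∂(multivariateGaussian 0 Γ)) ^ 2)⁻¹ * ((∫ ω : EuclideanSpace ℝ ι, exp (-U (ω + ψ₀)) * U₄ (ω + ψ₀) m h k l ∂(multivariateGaussian 0 Γ)) * (∫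
          ω : EuclideanSpace ℝ ι, exp (-U (ω + ψ₀)) * U' (ω + ψ₀) n ∂(multivariateGaussian 0 Γ))))) 0 := by
  have h1 := hasDerivAt_tilted_mean_line (p := (fun φ => U₄ φ m h k l)) (p' := (fun φ => ((((ContinuousLinearMap.apply ℝ ℝ l).comp
      (ContinuousLinearMap.apply ℝ (EuclideanSpace ℝ ι →L[ℝ] ℝ) k)).comp (ContinuousLinearMap.apply ℝ (EuclideanSpace ℝ ι →L[ℝ] EuclideanSpace ℝ ι
      →L[ℝ] ℝ) h)).comp (ContinuousLinearMap.apply ℝ (EuclideanSpace ℝ ι →L[ℝ] EuclideanSpace ℝ ι →L[ℝ] EuclideanSpace ℝ ι →L[ℝ] ℝ) m)).comp (U₅ φ)))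
      hΓ hΓop Y hUd hU'd hκ₀ hκ₁ ha hτ hδ hθ0 hθ1 hκθ hstab hU'b hU''b
    (hasFDerivAt_entry_four hU₄d m h k l) (continuous_entry_four_fderiv hU₅c m h k l)
    (class_fourth_abs_le hU₄b hU₅b m h k l) (class_fourth_fderiv_le hU₄b hU₅b m h k l) ψ₀ n
  simp only [entry_four_fderiv_apply] at h1
  exact h1

set_option synthInstance.maxHeartbeats 200000 in
/-- **The `Cov(C,A)` group**: the four raw covariances `Cov(U‴·,U′·)` of (521)'s display differentiated along `n` (RULE 2 ×4). [folklore] -/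
theorem hasDerivAt_display4_covCA_line (hΓ : Γ.PosSemidef) (hΓop : (γop • (1 : Matrix ι ι ℝ) - Γ).PosSemidef) (Y : Finset ι)
    (hUd : ∀ φ : EuclideanSpace ℝ ι, HasFDerivAt U (U' φ) φ) (hU'd : ∀ φ : EuclideanSpace ℝ ι, HasFDerivAt U' (U'' φ) φ)
    (hU''d : ∀ φ : EuclideanSpace ℝ ι, HasFDerivAt U'' (U₃ φ) φ) (hU₃d : ∀ φ : EuclideanSpace ℝ ι, HasFDerivAt U₃ (U₄ φ) φ) (hU₄c : Continuous U₄)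
    (hκ₀ : 0 ≤ κ₀) (hκ₁ : 0 ≤ κ₁) (ha : 0 ≤ a) (hτ : 0 < τ) (hδ : 0 < δ) (hθ0 : 0 < θ) (hθ1 : θ < 1) (hκθ : (2 * κ₀ * (1 + τ) + 4 * δ) * γop ≤ θ)
    (hstab : ∀ φ : EuclideanSpace ℝ ι, -(κ₀ * ∑ x ∈ Y, φ x ^ 2) ≤ U φ) (hU'b : ∀ φ : EuclideanSpace ℝ ι, ‖U' φ‖ ≤ κ₁ * (a + ∑ x ∈ Y, φ x ^ 2))
    (hU''b : ∀ φ : EuclideanSpace ℝ ι, ‖U'' φ‖ ≤ κ₂) (hU₃b : ∀ φ : EuclideanSpace ℝ ι, ‖U₃ φ‖ ≤ κ₃) (hU₄b : ∀ φ : EuclideanSpace ℝ ι, ‖U₄ φ‖ ≤ κ₄)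
        (ψ₀ n m h k l : EuclideanSpace ℝ ι) :
    HasDerivAt (fun s : ℝ => ((∫ ω : EuclideanSpace ℝ ι, exp (-U (ω + (ψ₀ + s • n))) ∂(multivariateGaussian 0 Γ))⁻¹ * (∫ ω : EuclideanSpace ℝ ι, exp
        (-U (ω + (ψ₀ + s • n))) * (U₃ (ω + (ψ₀ + s • n)) m k l * U' (ω + (ψ₀ + s • n)) h) ∂(multivariateGaussian 0 Γ)) - ((∫ ω : EuclideanSpace ℝ ι,
        exp (-U (ω + (ψ₀ + s • n))) ∂(multivariateGaussian 0 Γ)) ^ 2)⁻¹ * ((∫ ω : EuclideanSpace ℝ ι, exp (-U (ω + (ψ₀ + s • n))) * U₃ (ω + (ψ₀ + s •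
        n)) m k l ∂(multivariateGaussian 0 Γ)) * (∫ ω : EuclideanSpace ℝ ι, exp (-U (ω + (ψ₀ + s • n))) * U' (ω + (ψ₀ + s • n)) h
        ∂(multivariateGaussian 0 Γ)))) +
        ((∫ ω : EuclideanSpace ℝ ι, exp (-U (ω + (ψ₀ + s • n))) ∂(multivariateGaussian 0 Γ))⁻¹ * (∫ ω : EuclideanSpace ℝ ι, exp (-U (ω + (ψ₀ + s •
            n))) * (U₃ (ω + (ψ₀ + s • n)) m h l * U' (ω + (ψ₀ + s • n)) k) ∂(multivariateGaussian 0 Γ)) - ((∫ ω : EuclideanSpace ℝ ι, exp (-U (ω +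
            (ψ₀ + s • n))) ∂(multivariateGaussian 0 Γ)) ^ 2)⁻¹ * ((∫ ω : EuclideanSpace ℝ ι, exp (-U (ω + (ψ₀ + s • n))) * U₃ (ω + (ψ₀ + s • n)) m h
            l ∂(multivariateGaussian 0 Γ)) * (∫ ω : EuclideanSpace ℝ ι, exp (-U (ω + (ψ₀ + s • n))) * U' (ω + (ψ₀ + s • n)) k ∂(multivariateGaussian
            0 Γ)))) +
        ((∫ ω : EuclideanSpace ℝ ι, exp (-U (ω + (ψ₀ + s • n))) ∂(multivariateGaussian 0 Γ))⁻¹ * (∫ ω : EuclideanSpace ℝ ι, exp (-U (ω + (ψ₀ + s •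
            n))) * (U₃ (ω + (ψ₀ + s • n)) m h k * U' (ω + (ψ₀ + s • n)) l) ∂(multivariateGaussian 0 Γ)) - ((∫ ω : EuclideanSpace ℝ ι, exp (-U (ω +
            (ψ₀ + s • n))) ∂(multivariateGaussian 0 Γ)) ^ 2)⁻¹ * ((∫ ω : EuclideanSpace ℝ ι, exp (-U (ω + (ψ₀ + s • n))) * U₃ (ω + (ψ₀ + s • n)) m h
            k ∂(multivariateGaussian 0 Γ)) * (∫ ω : EuclideanSpace ℝ ι, exp (-U (ω + (ψ₀ + s • n))) * U' (ω + (ψ₀ + s • n)) l ∂(multivariateGaussian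
            0 Γ)))) +
        ((∫ ω : EuclideanSpace ℝ ι, exp (-U (ω + (ψ₀ + s • n))) ∂(multivariateGaussian 0 Γ))⁻¹ * (∫ ω : EuclideanSpace ℝ ι, exp (-U (ω + (ψ₀ + s •
            n))) * (U' (ω + (ψ₀ + s • n)) m * U₃ (ω + (ψ₀ + s • n)) h k l) ∂(multivariateGaussian 0 Γ)) - ((∫ ω : EuclideanSpace ℝ ι, exp (-U (ω +
            (ψ₀ + s • n))) ∂(multivariateGaussian 0 Γ)) ^ 2)⁻¹ * ((∫ ω : EuclideanSpace ℝ ι, exp (-U (ω + (ψ₀ + s • n))) * U' (ω + (ψ₀ + s • n)) m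
            ∂(multivariateGaussian 0 Γ)) * (∫ ω : EuclideanSpace ℝ ι, exp (-U (ω + (ψ₀ + s • n))) * U₃ (ω + (ψ₀ + s • n)) h k l
            ∂(multivariateGaussian 0 Γ)))))
      ((((∫ ω : EuclideanSpace ℝ ι, exp (-U (ω + ψ₀)) ∂(multivariateGaussian 0 Γ))⁻¹ * (∫ ω : EuclideanSpace ℝ ι, exp (-U (ω + ψ₀)) * (U₄ (ω + ψ₀) n
          m k l * U' (ω + ψ₀) h) ∂(multivariateGaussian 0 Γ)) - ((∫ ω : EuclideanSpace ℝ ι, exp (-U (ω + ψ₀)) ∂(multivariateGaussian 0 Γ)) ^ 2)⁻¹ *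
          ((∫ ω : EuclideanSpace ℝ ι, exp (-U (ω + ψ₀)) * U₄ (ω + ψ₀) n m k l ∂(multivariateGaussian 0 Γ)) * (∫ ω : EuclideanSpace ℝ ι, exp (-U (ω +
          ψ₀)) * U' (ω + ψ₀) h ∂(multivariateGaussian 0 Γ)))) +
        ((∫ ω : EuclideanSpace ℝ ι, exp (-U (ω + ψ₀)) ∂(multivariateGaussian 0 Γ))⁻¹ * (∫ ω : EuclideanSpace ℝ ι, exp (-U (ω + ψ₀)) * (U₃ (ω + ψ₀) m
            k l * U'' (ω + ψ₀) n h) ∂(multivariateGaussian 0 Γ)) - ((∫ ω : EuclideanSpace ℝ ι, exp (-U (ω + ψ₀)) ∂(multivariateGaussian 0 Γ)) ^ 2)⁻¹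
            * ((∫ ω : EuclideanSpace ℝ ι, exp (-U (ω + ψ₀)) * U₃ (ω + ψ₀) m k l ∂(multivariateGaussian 0 Γ)) * (∫ ω : EuclideanSpace ℝ ι, exp (-U (ω
            + ψ₀)) * U'' (ω + ψ₀) n h ∂(multivariateGaussian 0 Γ)))) -
        ((∫ ω : EuclideanSpace ℝ ι, exp (-U (ω + ψ₀)) ∂(multivariateGaussian 0 Γ))⁻¹ * (∫ ω : EuclideanSpace ℝ ι, exp (-U (ω + ψ₀)) * ((U₃ (ω + ψ₀) m
            k l - ((∫ ω : EuclideanSpace ℝ ι, exp (-U (ω + ψ₀)) ∂(multivariateGaussian 0 Γ))⁻¹ * (∫ ω : EuclideanSpace ℝ ι, exp (-U (ω + ψ₀)) * U₃ (ω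
            + ψ₀) m k l ∂(multivariateGaussian 0 Γ)))) * (U' (ω + ψ₀) h - ((∫ ω : EuclideanSpace ℝ ι, exp (-U (ω + ψ₀)) ∂(multivariateGaussian 0
            Γ))⁻¹ * (∫ ω : EuclideanSpace ℝ ι, exp (-U (ω + ψ₀)) * U' (ω + ψ₀) h ∂(multivariateGaussian 0 Γ)))) * (U' (ω + ψ₀) n - ((∫ ω :
            EuclideanSpace ℝ ι, exp (-U (ω + ψ₀)) ∂(multivariateGaussian 0 Γ))⁻¹ * (∫ ω : EuclideanSpace ℝ ι, exp (-U (ω + ψ₀)) * U' (ω + ψ₀) n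
            ∂(multivariateGaussian 0 Γ))))) ∂(multivariateGaussian 0 Γ)))) +
        (((∫ ω : EuclideanSpace ℝ ι, exp (-U (ω + ψ₀)) ∂(multivariateGaussian 0 Γ))⁻¹ * (∫ ω : EuclideanSpace ℝ ι, exp (-U (ω + ψ₀)) * (U₄ (ω + ψ₀) n
            m h l * U' (ω + ψ₀) k) ∂(multivariateGaussian 0 Γ)) - ((∫ ω : EuclideanSpace ℝ ι, exp (-U (ω + ψ₀)) ∂(multivariateGaussian 0 Γ)) ^ 2)⁻¹ *
            ((∫ ω : EuclideanSpace ℝ ι, exp (-U (ω + ψ₀)) * U₄ (ω + ψ₀) n m h l ∂(multivariateGaussian 0 Γ)) * (∫ ω : EuclideanSpace ℝ ι, exp (-U (ω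
            + ψ₀)) * U' (ω + ψ₀) k ∂(multivariateGaussian 0 Γ)))) +
        ((∫ ω : EuclideanSpace ℝ ι, exp (-U (ω + ψ₀)) ∂(multivariateGaussian 0 Γ))⁻¹ * (∫ ω : EuclideanSpace ℝ ι, exp (-U (ω + ψ₀)) * (U₃ (ω + ψ₀) m
            h l * U'' (ω + ψ₀) n k) ∂(multivariateGaussian 0 Γ)) - ((∫ ω : EuclideanSpace ℝ ι, exp (-U (ω + ψ₀)) ∂(multivariateGaussian 0 Γ)) ^ 2)⁻¹
            * ((∫ ω : EuclideanSpace ℝ ι, exp (-U (ω + ψ₀)) * U₃ (ω + ψ₀) m h l ∂(multivariateGaussian 0 Γ)) * (∫ ω : EuclideanSpace ℝ ι, exp (-U (ω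
            + ψ₀)) * U'' (ω + ψ₀) n k ∂(multivariateGaussian 0 Γ)))) -
        ((∫ ω : EuclideanSpace ℝ ι, exp (-U (ω + ψ₀)) ∂(multivariateGaussian 0 Γ))⁻¹ * (∫ ω : EuclideanSpace ℝ ι, exp (-U (ω + ψ₀)) * ((U₃ (ω + ψ₀) m
            h l - ((∫ ω : EuclideanSpace ℝ ι, exp (-U (ω + ψ₀)) ∂(multivariateGaussian 0 Γ))⁻¹ * (∫ ω : EuclideanSpace ℝ ι, exp (-U (ω + ψ₀)) * U₃ (ω
            + ψ₀) m h l ∂(multivariateGaussian 0 Γ)))) * (U' (ω + ψ₀) k - ((∫ ω : EuclideanSpace ℝ ι, exp (-U (ω + ψ₀)) ∂(multivariateGaussian 0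
            Γ))⁻¹ * (∫ ω : EuclideanSpace ℝ ι, exp (-U (ω + ψ₀)) * U' (ω + ψ₀) k ∂(multivariateGaussian 0 Γ)))) * (U' (ω + ψ₀) n - ((∫ ω :
            EuclideanSpace ℝ ι, exp (-U (ω + ψ₀)) ∂(multivariateGaussian 0 Γ))⁻¹ * (∫ ω : EuclideanSpace ℝ ι, exp (-U (ω + ψ₀)) * U' (ω + ψ₀) n
            ∂(multivariateGaussian 0 Γ))))) ∂(multivariateGaussian 0 Γ)))) +
        (((∫ ω : EuclideanSpace ℝ ι, exp (-U (ω + ψ₀)) ∂(multivariateGaussian 0 Γ))⁻¹ * (∫ ω : EuclideanSpace ℝ ι, exp (-U (ω + ψ₀)) * (U₄ (ω + ψ₀) n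
            m h k * U' (ω + ψ₀) l) ∂(multivariateGaussian 0 Γ)) - ((∫ ω : EuclideanSpace ℝ ι, exp (-U (ω + ψ₀)) ∂(multivariateGaussian 0 Γ)) ^ 2)⁻¹ *
            ((∫ ω : EuclideanSpace ℝ ι, exp (-U (ω + ψ₀)) * U₄ (ω + ψ₀) n m h k ∂(multivariateGaussian 0 Γ)) * (∫ ω : EuclideanSpace ℝ ι, exp (-U (ω
            + ψ₀)) * U' (ω + ψ₀) l ∂(multivariateGaussian 0 Γ)))) +
        ((∫ ω : EuclideanSpace ℝ ι, exp (-U (ω + ψ₀)) ∂(multivariateGaussian 0 Γ))⁻¹ * (∫ ω : EuclideanSpace ℝ ι, exp (-U (ω + ψ₀)) * (U₃ (ω + ψ₀) m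
            h k * U'' (ω + ψ₀) n l) ∂(multivariateGaussian 0 Γ)) - ((∫ ω : EuclideanSpace ℝ ι, exp (-U (ω + ψ₀)) ∂(multivariateGaussian 0 Γ)) ^ 2)⁻¹
            * ((∫ ω : EuclideanSpace ℝ ι, exp (-U (ω + ψ₀)) * U₃ (ω + ψ₀) m h k ∂(multivariateGaussian 0 Γ)) * (∫ ω : EuclideanSpace ℝ ι, exp (-U (ω
            + ψ₀)) * U'' (ω + ψ₀) n l ∂(multivariateGaussian 0 Γ)))) -
        ((∫ ω : EuclideanSpace ℝ ι, exp (-U (ω + ψ₀)) ∂(multivariateGaussian 0 Γ))⁻¹ * (∫ ω : EuclideanSpace ℝ ι, exp (-U (ω + ψ₀)) * ((U₃ (ω + ψ₀) m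
            h k - ((∫ ω : EuclideanSpace ℝ ι, exp (-U (ω + ψ₀)) ∂(multivariateGaussian 0 Γ))⁻¹ * (∫ ω : EuclideanSpace ℝ ι, exp (-U (ω + ψ₀)) * U₃ (ω
            + ψ₀) m h k ∂(multivariateGaussian 0 Γ)))) * (U' (ω + ψ₀) l - ((∫ ω : EuclideanSpace ℝ ι, exp (-U (ω + ψ₀)) ∂(multivariateGaussian 0
            Γ))⁻¹ * (∫ ω : EuclideanSpace ℝ ι, exp (-U (ω + ψ₀)) * U' (ω + ψ₀) l ∂(multivariateGaussian 0 Γ)))) * (U' (ω + ψ₀) n - ((∫ ω :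
            EuclideanSpace ℝ ι, exp (-U (ω + ψ₀)) ∂(multivariateGaussian 0 Γ))⁻¹ * (∫ ω : EuclideanSpace ℝ ι, exp (-U (ω + ψ₀)) * U' (ω + ψ₀) n
            ∂(multivariateGaussian 0 Γ))))) ∂(multivariateGaussian 0 Γ)))) +
        (((∫ ω : EuclideanSpace ℝ ι, exp (-U (ω + ψ₀)) ∂(multivariateGaussian 0 Γ))⁻¹ * (∫ ω : EuclideanSpace ℝ ι, exp (-U (ω + ψ₀)) * (U'' (ω + ψ₀)
            n m * U₃ (ω + ψ₀) h k l) ∂(multivariateGaussian 0 Γ)) - ((∫ ω : EuclideanSpace ℝ ι, exp (-U (ω + ψ₀)) ∂(multivariateGaussian 0 Γ)) ^ 2)⁻¹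
            * ((∫ ω : EuclideanSpace ℝ ι, exp (-U (ω + ψ₀)) * U'' (ω + ψ₀) n m ∂(multivariateGaussian 0 Γ)) * (∫ ω : EuclideanSpace ℝ ι, exp (-U (ω +
            ψ₀)) * U₃ (ω + ψ₀) h k l ∂(multivariateGaussian 0 Γ)))) +
        ((∫ ω : EuclideanSpace ℝ ι, exp (-U (ω + ψ₀)) ∂(multivariateGaussian 0 Γ))⁻¹ * (∫ ω : EuclideanSpace ℝ ι, exp (-U (ω + ψ₀)) * (U' (ω + ψ₀) m
            * U₄ (ω + ψ₀) n h k l) ∂(multivariateGaussian 0 Γ)) - ((∫ ω : EuclideanSpace ℝ ι, exp (-U (ω + ψ₀)) ∂(multivariateGaussian 0 Γ)) ^ 2)⁻¹ *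
            ((∫ ω : EuclideanSpace ℝ ι, exp (-U (ω + ψ₀)) * U' (ω + ψ₀) m ∂(multivariateGaussian 0 Γ)) * (∫ ω : EuclideanSpace ℝ ι, exp (-U (ω + ψ₀))
            * U₄ (ω + ψ₀) n h k l ∂(multivariateGaussian 0 Γ)))) -
        ((∫ ω : EuclideanSpace ℝ ι, exp (-U (ω + ψ₀)) ∂(multivariateGaussian 0 Γ))⁻¹ * (∫ ω : EuclideanSpace ℝ ι, exp (-U (ω + ψ₀)) * ((U' (ω + ψ₀) m
            - ((∫ ω : EuclideanSpace ℝ ι, exp (-U (ω + ψ₀)) ∂(multivariateGaussian 0 Γ))⁻¹ * (∫ ω : EuclideanSpace ℝ ι, exp (-U (ω + ψ₀)) * U' (ω +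
            ψ₀) m ∂(multivariateGaussian 0 Γ)))) * (U₃ (ω + ψ₀) h k l - ((∫ ω : EuclideanSpace ℝ ι, exp (-U (ω + ψ₀)) ∂(multivariateGaussian 0 Γ))⁻¹
            * (∫ ω : EuclideanSpace ℝ ι, exp (-U (ω + ψ₀)) * U₃ (ω + ψ₀) h k l ∂(multivariateGaussian 0 Γ)))) * (U' (ω + ψ₀) n - ((∫ ω :
            EuclideanSpace ℝ ι, exp (-U (ω + ψ₀)) ∂(multivariateGaussian 0 Γ))⁻¹ * (∫ ω : EuclideanSpace ℝ ι, exp (-U (ω + ψ₀)) * U' (ω + ψ₀) n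
            ∂(multivariateGaussian 0 Γ))))) ∂(multivariateGaussian 0 Γ))))) 0 := by
  have hU''c : Continuous U'' := continuous_iff_continuousAt.2 fun φ => (hU''d φ).continuousAt
  have hκ₂ : 0 ≤ κ₂ := (norm_nonneg (U'' ψ₀)).trans (hU''b ψ₀)
  have h1 := hasDerivAt_tilted_cov_line (p := (fun φ => U₃ φ m k l)) (p' := (fun φ => (((ContinuousLinearMap.apply ℝ ℝ l).comp
      (ContinuousLinearMap.apply ℝ (EuclideanSpace ℝ ι →L[ℝ] ℝ) k)).comp (ContinuousLinearMap.apply ℝ (EuclideanSpace ℝ ι →L[ℝ] EuclideanSpace ℝ ι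
      →L[ℝ] ℝ) m)).comp (U₄ φ)))
    (q := (fun φ => U' φ h)) (q' := (fun φ => (ContinuousLinearMap.apply ℝ ℝ h).comp (U'' φ))) hΓ hΓop Y hUd hU'd hκ₀ hκ₁ ha hτ hδ hθ0 hθ1 hκθ hstab
        hU'b hU''b
    (hasFDerivAt_entry_three hU₃d m k l) (continuous_entry_three_fderiv hU₄c m k l)
    (class_third_abs_le hU₃b hU₄b m k l) (class_third_fderiv_le hU₃b hU₄b m k l)
    (hasFDerivAt_entry_one hU'd h) (continuous_entry_one_fderiv hU''c h) (fun φ => class_grad_abs_le hκ₂ φ h)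
    (fun φ => class_grad_fderiv_le hU''b φ h) ψ₀ n
  have h2 := hasDerivAt_tilted_cov_line (p := (fun φ => U₃ φ m h l)) (p' := (fun φ => (((ContinuousLinearMap.apply ℝ ℝ l).comp
      (ContinuousLinearMap.apply ℝ (EuclideanSpace ℝ ι →L[ℝ] ℝ) h)).comp (ContinuousLinearMap.apply ℝ (EuclideanSpace ℝ ι →L[ℝ] EuclideanSpace ℝ ι
      →L[ℝ] ℝ) m)).comp (U₄ φ)))
    (q := (fun φ => U' φ k)) (q' := (fun φ => (ContinuousLinearMap.apply ℝ ℝ k).comp (U'' φ))) hΓ hΓop Y hUd hU'd hκ₀ hκ₁ ha hτ hδ hθ0 hθ1 hκθ hstab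
        hU'b hU''b
    (hasFDerivAt_entry_three hU₃d m h l) (continuous_entry_three_fderiv hU₄c m h l)
    (class_third_abs_le hU₃b hU₄b m h l) (class_third_fderiv_le hU₃b hU₄b m h l)
    (hasFDerivAt_entry_one hU'd k) (continuous_entry_one_fderiv hU''c k) (fun φ => class_grad_abs_le hκ₂ φ k)
    (fun φ => class_grad_fderiv_le hU''b φ k) ψ₀ n
  have h3 := hasDerivAt_tilted_cov_line (p := (fun φ => U₃ φ m h k)) (p' := (fun φ => (((ContinuousLinearMap.apply ℝ ℝ k).comp
      (ContinuousLinearMap.apply ℝ (EuclideanSpace ℝ ι →L[ℝ] ℝ) h)).comp (ContinuousLinearMap.apply ℝ (EuclideanSpace ℝ ι →L[ℝ] EuclideanSpace ℝ ι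
      →L[ℝ] ℝ) m)).comp (U₄ φ)))
    (q := (fun φ => U' φ l)) (q' := (fun φ => (ContinuousLinearMap.apply ℝ ℝ l).comp (U'' φ))) hΓ hΓop Y hUd hU'd hκ₀ hκ₁ ha hτ hδ hθ0 hθ1 hκθ hstab
        hU'b hU''b
    (hasFDerivAt_entry_three hU₃d m h k) (continuous_entry_three_fderiv hU₄c m h k)
    (class_third_abs_le hU₃b hU₄b m h k) (class_third_fderiv_le hU₃b hU₄b m h k)
    (hasFDerivAt_entry_one hU'd l) (continuous_entry_one_fderiv hU''c l) (fun φ => class_grad_abs_le hκ₂ φ l)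
    (fun φ => class_grad_fderiv_le hU''b φ l) ψ₀ n
  have h4 := hasDerivAt_tilted_cov_line (p := (fun φ => U' φ m)) (p' := (fun φ => (ContinuousLinearMap.apply ℝ ℝ m).comp (U'' φ)))
    (q := (fun φ => U₃ φ h k l)) (q' := (fun φ => (((ContinuousLinearMap.apply ℝ ℝ l).comp (ContinuousLinearMap.apply ℝ (EuclideanSpace ℝ ι →L[ℝ] ℝ)
        k)).comp (ContinuousLinearMap.apply ℝ (EuclideanSpace ℝ ι →L[ℝ] EuclideanSpace ℝ ι →L[ℝ] ℝ) h)).comp (U₄ φ))) hΓ hΓop Y hUd hU'd hκ₀ hκ₁ ha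
        hτ hδ hθ0 hθ1 hκθ hstab hU'b hU''b
    (hasFDerivAt_entry_one hU'd m) (continuous_entry_one_fderiv hU''c m) (fun φ => class_grad_abs_le hκ₂ φ m)
    (fun φ => class_grad_fderiv_le hU''b φ m)
    (hasFDerivAt_entry_three hU₃d h k l) (continuous_entry_three_fderiv hU₄c h k l)
    (class_third_abs_le hU₃b hU₄b h k l) (class_third_fderiv_le hU₃b hU₄b h k l) ψ₀ n
  have hs := ((h1.add h2).add h3).add h4
  simp only [Pi.add_def, entry_three_fderiv_apply, entry_one_fderiv_apply] at hs
  exact hs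

set_option synthInstance.maxHeartbeats 200000 in
/-- **The `Cov(B,B)` group**: the three raw covariances `Cov(U″·,U″·)` differentiated along `n` (RULE 2 ×3). [folklore] -/
theorem hasDerivAt_display4_covBB_line (hΓ : Γ.PosSemidef) (hΓop : (γop • (1 : Matrix ι ι ℝ) - Γ).PosSemidef) (Y : Finset ι)
    (hUd : ∀ φ : EuclideanSpace ℝ ι, HasFDerivAt U (U' φ) φ) (hU'd : ∀ φ : EuclideanSpace ℝ ι, HasFDerivAt U' (U'' φ) φ)
    (hU''d : ∀ φ : EuclideanSpace ℝ ι, HasFDerivAt U'' (U₃ φ) φ) (hU₃c : Continuous U₃)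
    (hκ₀ : 0 ≤ κ₀) (hκ₁ : 0 ≤ κ₁) (ha : 0 ≤ a) (hτ : 0 < τ) (hδ : 0 < δ) (hθ0 : 0 < θ) (hθ1 : θ < 1) (hκθ : (2 * κ₀ * (1 + τ) + 4 * δ) * γop ≤ θ)
    (hstab : ∀ φ : EuclideanSpace ℝ ι, -(κ₀ * ∑ x ∈ Y, φ x ^ 2) ≤ U φ) (hU'b : ∀ φ : EuclideanSpace ℝ ι, ‖U' φ‖ ≤ κ₁ * (a + ∑ x ∈ Y, φ x ^ 2))
    (hU''b : ∀ φ : EuclideanSpace ℝ ι, ‖U'' φ‖ ≤ κ₂) (hU₃b : ∀ φ : EuclideanSpace ℝ ι, ‖U₃ φ‖ ≤ κ₃) (ψ₀ n m h k l : EuclideanSpace ℝ ι) :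
    HasDerivAt (fun s : ℝ => ((∫ ω : EuclideanSpace ℝ ι, exp (-U (ω + (ψ₀ + s • n))) ∂(multivariateGaussian 0 Γ))⁻¹ * (∫ ω : EuclideanSpace ℝ ι, exp
        (-U (ω + (ψ₀ + s • n))) * (U'' (ω + (ψ₀ + s • n)) m h * U'' (ω + (ψ₀ + s • n)) k l) ∂(multivariateGaussian 0 Γ)) - ((∫ ω : EuclideanSpace ℝ
        ι, exp (-U (ω + (ψ₀ + s • n))) ∂(multivariateGaussian 0 Γ)) ^ 2)⁻¹ * ((∫ ω : EuclideanSpace ℝ ι, exp (-U (ω + (ψ₀ + s • n))) * U'' (ω + (ψ₀ +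
        s • n)) m h ∂(multivariateGaussian 0 Γ)) * (∫ ω : EuclideanSpace ℝ ι, exp (-U (ω + (ψ₀ + s • n))) * U'' (ω + (ψ₀ + s • n)) k l
        ∂(multivariateGaussian 0 Γ)))) +
        ((∫ ω : EuclideanSpace ℝ ι, exp (-U (ω + (ψ₀ + s • n))) ∂(multivariateGaussian 0 Γ))⁻¹ * (∫ ω : EuclideanSpace ℝ ι, exp (-U (ω + (ψ₀ + s •
            n))) * (U'' (ω + (ψ₀ + s • n)) m k * U'' (ω + (ψ₀ + s • n)) h l) ∂(multivariateGaussian 0 Γ)) - ((∫ ω : EuclideanSpace ℝ ι, exp (-U (ω +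
            (ψ₀ + s • n))) ∂(multivariateGaussian 0 Γ)) ^ 2)⁻¹ * ((∫ ω : EuclideanSpace ℝ ι, exp (-U (ω + (ψ₀ + s • n))) * U'' (ω + (ψ₀ + s • n)) m k
            ∂(multivariateGaussian 0 Γ)) * (∫ ω : EuclideanSpace ℝ ι, exp (-U (ω + (ψ₀ + s • n))) * U'' (ω + (ψ₀ + s • n)) h l ∂(multivariateGaussian
            0 Γ)))) +
        ((∫ ω : EuclideanSpace ℝ ι, exp (-U (ω + (ψ₀ + s • n))) ∂(multivariateGaussian 0 Γ))⁻¹ * (∫ ω : EuclideanSpace ℝ ι, exp (-U (ω + (ψ₀ + s •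
            n))) * (U'' (ω + (ψ₀ + s • n)) m l * U'' (ω + (ψ₀ + s • n)) h k) ∂(multivariateGaussian 0 Γ)) - ((∫ ω : EuclideanSpace ℝ ι, exp (-U (ω +
            (ψ₀ + s • n))) ∂(multivariateGaussian 0 Γ)) ^ 2)⁻¹ * ((∫ ω : EuclideanSpace ℝ ι, exp (-U (ω + (ψ₀ + s • n))) * U'' (ω + (ψ₀ + s • n)) m l
            ∂(multivariateGaussian 0 Γ)) * (∫ ω : EuclideanSpace ℝ ι, exp (-U (ω + (ψ₀ + s • n))) * U'' (ω + (ψ₀ + s • n)) h k ∂(multivariateGaussian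
            0 Γ)))))
      ((((∫ ω : EuclideanSpace ℝ ι, exp (-U (ω + ψ₀)) ∂(multivariateGaussian 0 Γ))⁻¹ * (∫ ω : EuclideanSpace ℝ ι, exp (-U (ω + ψ₀)) * (U₃ (ω + ψ₀) n
          m h * U'' (ω + ψ₀) k l) ∂(multivariateGaussian 0 Γ)) - ((∫ ω : EuclideanSpace ℝ ι, exp (-U (ω + ψ₀)) ∂(multivariateGaussian 0 Γ)) ^ 2)⁻¹ *
          ((∫ ω : EuclideanSpace ℝ ι, exp (-U (ω + ψ₀)) * U₃ (ω + ψ₀) n m h ∂(multivariateGaussian 0 Γ)) * (∫ ω : EuclideanSpace ℝ ι, exp (-U (ω +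
          ψ₀)) * U'' (ω + ψ₀) k l ∂(multivariateGaussian 0 Γ)))) +
        ((∫ ω : EuclideanSpace ℝ ι, exp (-U (ω + ψ₀)) ∂(multivariateGaussian 0 Γ))⁻¹ * (∫ ω : EuclideanSpace ℝ ι, exp (-U (ω + ψ₀)) * (U'' (ω + ψ₀) m
            h * U₃ (ω + ψ₀) n k l) ∂(multivariateGaussian 0 Γ)) - ((∫ ω : EuclideanSpace ℝ ι, exp (-U (ω + ψ₀)) ∂(multivariateGaussian 0 Γ)) ^ 2)⁻¹ *
            ((∫ ω : EuclideanSpace ℝ ι, exp (-U (ω + ψ₀)) * U'' (ω + ψ₀) m h ∂(multivariateGaussian 0 Γ)) * (∫ ω : EuclideanSpace ℝ ι, exp (-U (ω +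
            ψ₀)) * U₃ (ω + ψ₀) n k l ∂(multivariateGaussian 0 Γ)))) -
        ((∫ ω : EuclideanSpace ℝ ι, exp (-U (ω + ψ₀)) ∂(multivariateGaussian 0 Γ))⁻¹ * (∫ ω : EuclideanSpace ℝ ι, exp (-U (ω + ψ₀)) * ((U'' (ω + ψ₀)
            m h - ((∫ ω : EuclideanSpace ℝ ι, exp (-U (ω + ψ₀)) ∂(multivariateGaussian 0 Γ))⁻¹ * (∫ ω : EuclideanSpace ℝ ι, exp (-U (ω + ψ₀)) * U''
            (ω + ψ₀) m h ∂(multivariateGaussian 0 Γ)))) * (U'' (ω + ψ₀) k l - ((∫ ω : EuclideanSpace ℝ ι, exp (-U (ω + ψ₀)) ∂(multivariateGaussian 0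
            Γ))⁻¹ * (∫ ω : EuclideanSpace ℝ ι, exp (-U (ω + ψ₀)) * U'' (ω + ψ₀) k l ∂(multivariateGaussian 0 Γ)))) * (U' (ω + ψ₀) n - ((∫ ω :
            EuclideanSpace ℝ ι, exp (-U (ω + ψ₀)) ∂(multivariateGaussian 0 Γ))⁻¹ * (∫ ω : EuclideanSpace ℝ ι, exp (-U (ω + ψ₀)) * U' (ω + ψ₀) n
            ∂(multivariateGaussian 0 Γ))))) ∂(multivariateGaussian 0 Γ)))) +
        (((∫ ω : EuclideanSpace ℝ ι, exp (-U (ω + ψ₀)) ∂(multivariateGaussian 0 Γ))⁻¹ * (∫ ω : EuclideanSpace ℝ ι, exp (-U (ω + ψ₀)) * (U₃ (ω + ψ₀) n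
            m k * U'' (ω + ψ₀) h l) ∂(multivariateGaussian 0 Γ)) - ((∫ ω : EuclideanSpace ℝ ι, exp (-U (ω + ψ₀)) ∂(multivariateGaussian 0 Γ)) ^ 2)⁻¹
            * ((∫ ω : EuclideanSpace ℝ ι, exp (-U (ω + ψ₀)) * U₃ (ω + ψ₀) n m k ∂(multivariateGaussian 0 Γ)) * (∫ ω : EuclideanSpace ℝ ι, exp (-U (ω
            + ψ₀)) * U'' (ω + ψ₀) h l ∂(multivariateGaussian 0 Γ)))) +
        ((∫ ω : EuclideanSpace ℝ ι, exp (-U (ω + ψ₀)) ∂(multivariateGaussian 0 Γ))⁻¹ * (∫ ω : EuclideanSpace ℝ ι, exp (-U (ω + ψ₀)) * (U'' (ω + ψ₀) m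
            k * U₃ (ω + ψ₀) n h l) ∂(multivariateGaussian 0 Γ)) - ((∫ ω : EuclideanSpace ℝ ι, exp (-U (ω + ψ₀)) ∂(multivariateGaussian 0 Γ)) ^ 2)⁻¹ *
            ((∫ ω : EuclideanSpace ℝ ι, exp (-U (ω + ψ₀)) * U'' (ω + ψ₀) m k ∂(multivariateGaussian 0 Γ)) * (∫ ω : EuclideanSpace ℝ ι, exp (-U (ω +
            ψ₀)) * U₃ (ω + ψ₀) n h l ∂(multivariateGaussian 0 Γ)))) -
        ((∫ ω : EuclideanSpace ℝ ι, exp (-U (ω + ψ₀)) ∂(multivariateGaussian 0 Γ))⁻¹ * (∫ ω : EuclideanSpace ℝ ι, exp (-U (ω + ψ₀)) * ((U'' (ω + ψ₀)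
            m k - ((∫ ω : EuclideanSpace ℝ ι, exp (-U (ω + ψ₀)) ∂(multivariateGaussian 0 Γ))⁻¹ * (∫ ω : EuclideanSpace ℝ ι, exp (-U (ω + ψ₀)) * U''
            (ω + ψ₀) m k ∂(multivariateGaussian 0 Γ)))) * (U'' (ω + ψ₀) h l - ((∫ ω : EuclideanSpace ℝ ι, exp (-U (ω + ψ₀)) ∂(multivariateGaussian 0
            Γ))⁻¹ * (∫ ω : EuclideanSpace ℝ ι, exp (-U (ω + ψ₀)) * U'' (ω + ψ₀) h l ∂(multivariateGaussian 0 Γ)))) * (U' (ω + ψ₀) n - ((∫ ω :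
            EuclideanSpace ℝ ι, exp (-U (ω + ψ₀)) ∂(multivariateGaussian 0 Γ))⁻¹ * (∫ ω : EuclideanSpace ℝ ι, exp (-U (ω + ψ₀)) * U' (ω + ψ₀) n
            ∂(multivariateGaussian 0 Γ))))) ∂(multivariateGaussian 0 Γ)))) +
        (((∫ ω : EuclideanSpace ℝ ι, exp (-U (ω + ψ₀)) ∂(multivariateGaussian 0 Γ))⁻¹ * (∫ ω : EuclideanSpace ℝ ι, exp (-U (ω + ψ₀)) * (U₃ (ω + ψ₀) n
            m l * U'' (ω + ψ₀) h k) ∂(multivariateGaussian 0 Γ)) - ((∫ ω : EuclideanSpace ℝ ι, exp (-U (ω + ψ₀)) ∂(multivariateGaussian 0 Γ)) ^ 2)⁻¹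
            * ((∫ ω : EuclideanSpace ℝ ι, exp (-U (ω + ψ₀)) * U₃ (ω + ψ₀) n m l ∂(multivariateGaussian 0 Γ)) * (∫ ω : EuclideanSpace ℝ ι, exp (-U (ω
            + ψ₀)) * U'' (ω + ψ₀) h k ∂(multivariateGaussian 0 Γ)))) +
        ((∫ ω : EuclideanSpace ℝ ι, exp (-U (ω + ψ₀)) ∂(multivariateGaussian 0 Γ))⁻¹ * (∫ ω : EuclideanSpace ℝ ι, exp (-U (ω + ψ₀)) * (U'' (ω + ψ₀) m
            l * U₃ (ω + ψ₀) n h k) ∂(multivariateGaussian 0 Γ)) - ((∫ ω : EuclideanSpace ℝ ι, exp (-U (ω + ψ₀)) ∂(multivariateGaussian 0 Γ)) ^ 2)⁻¹ *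
            ((∫ ω : EuclideanSpace ℝ ι, exp (-U (ω + ψ₀)) * U'' (ω + ψ₀) m l ∂(multivariateGaussian 0 Γ)) * (∫ ω : EuclideanSpace ℝ ι, exp (-U (ω +
            ψ₀)) * U₃ (ω + ψ₀) n h k ∂(multivariateGaussian 0 Γ)))) -
        ((∫ ω : EuclideanSpace ℝ ι, exp (-U (ω + ψ₀)) ∂(multivariateGaussian 0 Γ))⁻¹ * (∫ ω : EuclideanSpace ℝ ι, exp (-U (ω + ψ₀)) * ((U'' (ω + ψ₀)
            m l - ((∫ ω : EuclideanSpace ℝ ι, exp (-U (ω + ψ₀)) ∂(multivariateGaussian 0 Γ))⁻¹ * (∫ ω : EuclideanSpace ℝ ι, exp (-U (ω + ψ₀)) * U''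
            (ω + ψ₀) m l ∂(multivariateGaussian 0 Γ)))) * (U'' (ω + ψ₀) h k - ((∫ ω : EuclideanSpace ℝ ι, exp (-U (ω + ψ₀)) ∂(multivariateGaussian 0
            Γ))⁻¹ * (∫ ω : EuclideanSpace ℝ ι, exp (-U (ω + ψ₀)) * U'' (ω + ψ₀) h k ∂(multivariateGaussian 0 Γ)))) * (U' (ω + ψ₀) n - ((∫ ω :
            EuclideanSpace ℝ ι, exp (-U (ω + ψ₀)) ∂(multivariateGaussian 0 Γ))⁻¹ * (∫ ω : EuclideanSpace ℝ ι, exp (-U (ω + ψ₀)) * U' (ω + ψ₀) n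
            ∂(multivariateGaussian 0 Γ))))) ∂(multivariateGaussian 0 Γ))))) 0 := by
  have h1 := hasDerivAt_tilted_cov_line (p := (fun φ => U'' φ m h)) (p' := (fun φ => ((ContinuousLinearMap.apply ℝ ℝ h).comp
      (ContinuousLinearMap.apply ℝ (EuclideanSpace ℝ ι →L[ℝ] ℝ) m)).comp (U₃ φ)))
    (q := (fun φ => U'' φ k l)) (q' := (fun φ => ((ContinuousLinearMap.apply ℝ ℝ l).comp (ContinuousLinearMap.apply ℝ (EuclideanSpace ℝ ι →L[ℝ] ℝ)
        k)).comp (U₃ φ))) hΓ hΓop Y hUd hU'd hκ₀ hκ₁ ha hτ hδ hθ0 hθ1 hκθ hstab hU'b hU''b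
    (hasFDerivAt_entry_two hU''d m h) (continuous_entry_two_fderiv hU₃c m h)
    (class_hess_abs_le hU''b hU₃b m h) (class_hess_fderiv_le hU''b hU₃b m h)
    (hasFDerivAt_entry_two hU''d k l) (continuous_entry_two_fderiv hU₃c k l)
    (class_hess_abs_le hU''b hU₃b k l) (class_hess_fderiv_le hU''b hU₃b k l) ψ₀ n
  have h2 := hasDerivAt_tilted_cov_line (p := (fun φ => U'' φ m k)) (p' := (fun φ => ((ContinuousLinearMap.apply ℝ ℝ k).comp
      (ContinuousLinearMap.apply ℝ (EuclideanSpace ℝ ι →L[ℝ] ℝ) m)).comp (U₃ φ)))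
    (q := (fun φ => U'' φ h l)) (q' := (fun φ => ((ContinuousLinearMap.apply ℝ ℝ l).comp (ContinuousLinearMap.apply ℝ (EuclideanSpace ℝ ι →L[ℝ] ℝ)
        h)).comp (U₃ φ))) hΓ hΓop Y hUd hU'd hκ₀ hκ₁ ha hτ hδ hθ0 hθ1 hκθ hstab hU'b hU''b
    (hasFDerivAt_entry_two hU''d m k) (continuous_entry_two_fderiv hU₃c m k)
    (class_hess_abs_le hU''b hU₃b m k) (class_hess_fderiv_le hU''b hU₃b m k)
    (hasFDerivAt_entry_two hU''d h l) (continuous_entry_two_fderiv hU₃c h l)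
    (class_hess_abs_le hU''b hU₃b h l) (class_hess_fderiv_le hU''b hU₃b h l) ψ₀ n
  have h3 := hasDerivAt_tilted_cov_line (p := (fun φ => U'' φ m l)) (p' := (fun φ => ((ContinuousLinearMap.apply ℝ ℝ l).comp
      (ContinuousLinearMap.apply ℝ (EuclideanSpace ℝ ι →L[ℝ] ℝ) m)).comp (U₃ φ)))
    (q := (fun φ => U'' φ h k)) (q' := (fun φ => ((ContinuousLinearMap.apply ℝ ℝ k).comp (ContinuousLinearMap.apply ℝ (EuclideanSpace ℝ ι →L[ℝ] ℝ)
        h)).comp (U₃ φ))) hΓ hΓop Y hUd hU'd hκ₀ hκ₁ ha hτ hδ hθ0 hθ1 hκθ hstab hU'b hU''b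
    (hasFDerivAt_entry_two hU''d m l) (continuous_entry_two_fderiv hU₃c m l)
    (class_hess_abs_le hU''b hU₃b m l) (class_hess_fderiv_le hU''b hU₃b m l)
    (hasFDerivAt_entry_two hU''d h k) (continuous_entry_two_fderiv hU₃c h k)
    (class_hess_abs_le hU''b hU₃b h k) (class_hess_fderiv_le hU''b hU₃b h k) ψ₀ n
  have hs := (h1.add h2).add h3
  simp only [Pi.add_def, entry_two_fderiv_apply] at hs
  exact hs

/-! ## Toy -/

/-- Toy (placements differentiated in this file): `2 + 12 + 9 = 23` of `52`. -/
example : 2 + 12 + 9 = 23 := by norm_num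

end Summit.QuantumFields.BalabanUV.T4Continuum.NE7b.SupFifthFormGroupsOne

end
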